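import Mathlib
import HarnessLib
import Summits.QuantumFields.YangMills.Theorems.LangevinControlUVOSLegsFromFemtoAndGapStubUpgrade
import Literature.MathematicalPhysics.AQFT.OSAxiomsSchwinger
import Literature.MathematicalPhysics.QuantumLattice.EuclideanAction

/-!
# `HypercubicLimit`, line `conditional-mean-telescoping` (c1 blocks): stub `rpBlock_signedPermGeneration`

Support file (`--supports stmt-QuantumFields-8646`) for crux
`Summit.QuantumFields.YangMills.Theses.PencilRigidity.HypercubicLimit`, line
`conditional-mean-telescoping`: the registered c1 block `rpBlock_signedPermGeneration` — **the signed
permutations of the axes of `ℝ⁴` (the hyperoctahedral group `W(B₄)`) are generated by the coordinate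
permutations and the time reflection**, in the form needed by the crux: a functional on `n`-point test
functions which is invariant on `⁰𝒮ₙ` under the diagonal action `linActMulti` of every coordinate
permutation `piLpCongrLeft 2 ℝ ℝ π` and under the diagonal time reflection `Θ = thetaMulti 4` is invariant
on `⁰𝒮ₙ` under `linActMulti R` for every linear isometry `R` mapping each axis vector `eᵢ` to some `±eⱼ`.

Route (tree vocabulary only). Work with a predicate `P` on `ℝ⁴ ≃ₗᵢ ℝ⁴` closed under composition and
holding on the identity, the coordinate permutations and `timeReflection 4`.
* The coordinate reflection `x_k ↦ -x_k` is the conjugate of the time reflection by the transposition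
  `(0 k)` of the coordinates (`sgnPerm_signFlip_single`), so `P` holds on it; a general sign change
  `signFlip ε` (`Theorems/NPointIsotropy/Negative/HyperoctahedralPlane.lean`) is the composite of the four
  single-axis sign changes (`sgnPerm_signFlip_trans`), so `P (signFlip ε)` (`sgnPerm_signFlip`).
* An axis-permuting isometry `R` is a signed permutation `sp τ δ = (signFlip δ).trans (permIso τ)`
  (`exists_sp_of_isHyper`, same file), hence `P R` (`sgnPerm_of_isHyper`).
* The invariance predicate `A ↦ ∀ F ∈ ⁰𝒮ₙ, Φ (linActMulti A F) = Φ F` is closed under composition and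
  holds on the identity (`linActMulti_trans_eq`, `linActMulti_refl_eq`, `isOffDiagonal_linActMulti` of
  `Theorems/LangevinControlUVOSLegsFromFemtoAndGapStubUpgrade.lean`), and `thetaMulti 4 = linActMulti
  (timeReflection 4)` by definition.

References: folklore (the hyperoctahedral group is generated by `S₄` and one coordinate reflection).
No definitions, no notation.
-/

noncomputable section

open scoped SchwartzMap
open Literature.MathematicalPhysics.AQFT Literature.MathematicalPhysics.QuantumLattice
open Literature.MathematicalPhysics.QuantumFieldTheory
open Summit.QuantumFields.YangMills.Theorems.NPointIsotropy.Negative (E4 sgn signFlip signFlip_apply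
  permIso permIso_apply sp IsHyper exists_sp_of_isHyper)
open Summit.QuantumFields.YangMills.Theorems.OSLegsFromFemtoAndGap.Upgrade (isOffDiagonal_linActMulti
  linActMulti_trans_eq linActMulti_refl_eq)

namespace Summit.QuantumFields.YangMills.Cruxes.HypercubicLimit.ConditionalMeanTelescoping

/-- **The coordinate reflection `x_k ↦ -x_k` is the conjugate of the time reflection by the
transposition `(0 k)` of the coordinates.** [folklore] -/
theorem sgnPerm_signFlip_single (k : Fin 4) :
    signFlip (fun j => decide (j = k)) =
      (permIso (Equiv.swap 0 k)).trans ((timeReflection 4).trans (permIso (Equiv.swap 0 k))) := by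
  ext x j
  simp only [LinearIsometryEquiv.trans_apply, signFlip_apply, permIso_apply, timeReflection_apply,
    Equiv.symm_swap, Equiv.swap_apply_self]
  by_cases hj : j = k
  · subst hj
    simp [sgn]
  · have hne : Equiv.swap (0 : Fin 4) k j ≠ 0 := by
      rw [Ne, Equiv.swap_apply_eq_iff, Equiv.swap_apply_left]
      exact hj
    simp [sgn, hj, hne]

/-- A sign change of the coordinates is the composite of the four single-axis sign changes
`x_k ↦ sgn (ε k) x_k`. [folklore] -/
theorem sgnPerm_signFlip_trans (ε : Fin 4 → Bool) :
    signFlip ε =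
      (signFlip fun j => decide (j = 0) && ε 0).trans ((signFlip fun j => decide (j = 1) && ε 1).trans
        ((signFlip fun j => decide (j = 2) && ε 2).trans (signFlip fun j => decide (j = 3) && ε 3))) := by
  ext x j
  simp only [LinearIsometryEquiv.trans_apply, signFlip_apply]
  fin_cases j <;> simp

/-- **Sign changes from permutations and the time reflection.** A predicate on the linear isometries of
`ℝ⁴` closed under composition and holding on the identity, on every coordinate permutation and on the
time reflection holds on every sign change of the coordinates. [folklore] -/
theorem sgnPerm_signFlip (P : (E4 ≃ₗᵢ[ℝ] E4) → Prop) (hmul : ∀ A B, P A → P B → P (A.trans B))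
    (hrefl : P (LinearIsometryEquiv.refl ℝ E4))
    (hperm : ∀ π : Equiv.Perm (Fin 4), P (LinearIsometryEquiv.piLpCongrLeft 2 ℝ ℝ π))
    (htheta : P (timeReflection 4)) (ε : Fin 4 → Bool) : P (signFlip ε) := by
  have hT : ∀ k : Fin 4, P (signFlip fun j => decide (j = k) && ε k) := by
    intro k
    cases ε k
    · have h0 : (signFlip fun j : Fin 4 => decide (j = k) && false) = LinearIsometryEquiv.refl ℝ E4 := by
        ext x j
        simp [signFlip_apply]
      rw [h0]
      exact hrefl
    · have h1 : (signFlip fun j : Fin 4 => decide (j = k) && true) = signFlip fun j => decide (j = k) := by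
        simp only [Bool.and_true]
      rw [h1, sgnPerm_signFlip_single k]
      exact hmul _ _ (hperm _) (hmul _ _ htheta (hperm _))
  rw [sgnPerm_signFlip_trans ε]
  exact hmul _ _ (hT 0) (hmul _ _ (hT 1) (hmul _ _ (hT 2) (hT 3)))

/-- **Generation of the hyperoctahedral group.** A predicate on the linear isometries of `ℝ⁴` closed
under composition and holding on the identity, on every coordinate permutation and on the time
reflection holds on every isometry mapping each axis vector `eᵢ` to some `±eⱼ` (such an isometry is a
sign change followed by a coordinate permutation, `exists_sp_of_isHyper`). [folklore] -/
theorem sgnPerm_of_isHyper (P : (E4 ≃ₗᵢ[ℝ] E4) → Prop) (hmul : ∀ A B, P A → P B → P (A.trans B))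
    (hrefl : P (LinearIsometryEquiv.refl ℝ E4))
    (hperm : ∀ π : Equiv.Perm (Fin 4), P (LinearIsometryEquiv.piLpCongrLeft 2 ℝ ℝ π))
    (htheta : P (timeReflection 4)) (R : E4 ≃ₗᵢ[ℝ] E4) (hR : IsHyper R) : P R := by
  obtain ⟨τ, δ, hsp⟩ := exists_sp_of_isHyper hR
  have hRsp : R = (signFlip δ).trans (permIso τ) := LinearIsometryEquiv.ext hsp
  rw [hRsp]
  exact hmul _ _ (sgnPerm_signFlip P hmul hrefl hperm htheta δ) (hperm τ)

/-- **Block GEN (signed permutations are generated by permutations and the time reflection).** A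
functional on `n`-point test functions which is invariant, on `⁰𝒮ₙ`, under the diagonal action of every
coordinate permutation of `ℝ⁴` and under the diagonal time reflection `Θ` is invariant on `⁰𝒮ₙ` under the
diagonal action of every linear isometry mapping each coordinate axis to a signed coordinate axis (the
hyperoctahedral group; the crux only needs its determinant-one part). [folklore] -/
theorem rpBlock_signedPermGeneration :
    ∀ (n : ℕ) (Φ : 𝓢((Fin n → EuclideanSpace ℝ (Fin 4)), ℂ) → ℂ),
      (∀ (π : Equiv.Perm (Fin 4)) (F : 𝓢((Fin n → EuclideanSpace ℝ (Fin 4)), ℂ)), IsOffDiagonal F →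
        Φ (linActMulti (LinearIsometryEquiv.piLpCongrLeft 2 ℝ ℝ π) F) = Φ F) →
      (∀ F : 𝓢((Fin n → EuclideanSpace ℝ (Fin 4)), ℂ), IsOffDiagonal F → Φ (thetaMulti 4 F) = Φ F) →
      ∀ R : EuclideanSpace ℝ (Fin 4) ≃ₗᵢ[ℝ] EuclideanSpace ℝ (Fin 4),
        (∀ i : Fin 4, ∃ j : Fin 4, R (EuclideanSpace.single i 1) = EuclideanSpace.single j 1 ∨
          R (EuclideanSpace.single i 1) = -EuclideanSpace.single j 1) →
        ∀ F : 𝓢((Fin n → EuclideanSpace ℝ (Fin 4)), ℂ), IsOffDiagonal F → Φ (linActMulti R F) = Φ F := by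
  intro n Φ hperm htheta R hR
  refine sgnPerm_of_isHyper
    (fun A => ∀ F : 𝓢((Fin n → EuclideanSpace ℝ (Fin 4)), ℂ), IsOffDiagonal F →
      Φ (linActMulti A F) = Φ F) ?_ ?_ hperm htheta R hR
  · intro A B hA hB F hF
    rw [linActMulti_trans_eq, hB _ (isOffDiagonal_linActMulti A hF), hA F hF]
  · intro F _
    rw [linActMulti_refl_eq]

end Summit.QuantumFields.YangMills.Cruxes.HypercubicLimit.ConditionalMeanTelescoping
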